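import Literature.AlgebraicGeometry.Motives.HodgeTheoremRepresentativeProofs
import Literature.NumberTheory.Transcendental.KaehlerHodgeSymmAssemblyProofs
import Literature.NumberTheory.Transcendental.KaehlerHodgeDelLaplacianGlueProofs
import Literature.NumberTheory.Transcendental.KaehlerHodgeTypeProofs
import Literature.NumberTheory.Transcendental.KaehlerHodgeComplexificationProofs
import Literature.NumberTheory.Transcendental.KaehlerHodgeOfRealProofs
import Literature.NumberTheory.Transcendental.KaehlerHodgeDecompositionProofs
import HarnessLib

/-!
# Hodge symmetry `h^{p,q} = h^{q,p}` from the real Hodge decomposition and the Kähler identity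

Theorems-only companion of `Literature/NumberTheory/Transcendental/KaehlerHodge.lean` for its named
fact `Literature.NumberTheory.Transcendental.hodgeNumber_symm_of_isKaehlerManifold` — Hodge symmetry of
the Hodge numbers `h^{p,q} = dim_ℂ H^{p,q}_{∂̄}` of a compact Hausdorff complex manifold admitting a
smooth Kähler metric (C. Voisin, *Hodge Theory and Complex Algebraic Geometry I* (2002), Cor. 6.12 with
Lemma 6.18; D. Huybrechts, *Complex Geometry* (2005), Cor. 3.2.12). No named fact is introduced; every
declaration of this file is proved.

## What this file adds

`KaehlerHodgeSymmProofs.lean` and `KaehlerHodgeSymmAssemblyProofs.lean` reduce the fact to (i) the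
Hodge theorem for `∂̄` on a compact Hermitian manifold (Voisin, Thm. 5.24 — ultimately Warner's analytic
Theorems 6.5/6.6 for the operator `Δ_∂̄` on `A^{p,q}(M)`, an input that is *not* a named fact of the
tree) and (ii) the Kähler identity `Δ_∂̄ = Δ_∂`. This file removes input (i) in favour of the *real*
Hodge theory the tree already carries for hodge.S08: on a compact **Kähler** manifold the Hodge
theorem for `∂̄` follows from the Hodge decomposition of the Riemannian Laplacian `Δ_d` and the Kähler
identity `Δ_d = 2Δ_∂̄` — the device Voisin uses for the `∂∂̄`-lemma (proof of Prop. 6.17, p. 122 of the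
PDF: "let `β = α + Δγ` be the decomposition of `β`, with `α` harmonic. As `Δ = 2Δ_∂̄` …") and for
Lemma 6.18. After this file the fact rests on exactly two existing named facts of the tree:

* **Warner's Theorem 6.8** (Hodge decomposition, third line, sum half: `E^p = H^p + dE^{p-1} +
  δE^{p+1}` for `1 ≤ p ≤ n - 1`), the hodge.S08 fact
  `Literature.AlgebraicGeometry.Motives.harmonicForms_sup_exactSmoothForms_sup_span_mcoderiv 𝓘(ℝ, E) o`
  (corrected closed form `…_of_compact`) of `Literature/AlgebraicGeometry/Motives/HodgeTheorem.lean`,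
  reduced there to Warner's Theorems 6.5/6.6 for `Δ_d`
  (`harmonicForms_sup_exactSmoothForms_sup_span_mcoderiv_of_regularity_of_compactness`);
* **Voisin's Theorem 6.7** `Δ_d = 2Δ_∂̄`, the corrected C12 fact
  `cHodgeLaplacian_eq_two_smul_dolbeaultLaplacian_of_isManifold_complex g o` (end of
  `KaehlerHodge.lean`), reduced in the tree to the first-order identities of Prop. 6.5.

These are the same two facts to which `Literature/AlgebraicGeometry/Motives/HodgeDecompositionHarmonicRepresentativeProofs.lean`
reduces hodge.S07 (`existsUnique_isDolbeaultHarmonic_of_mem_hodgePQ`), so that the Kähler package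
(Hodge decomposition and Hodge symmetry) now has a single analytic creditor, the elliptic theory of
`Δ_d`.

## Contents

* **Real forms (any compact oriented Riemannian manifold without boundary, `C^∞` metric).** Warner's
  Thm. 6.8, *first line from the third*: in every degree `Ωᵏ = Hᵏ + Δ(Ωᵏ)`
  (`exists_isHarmonicForm_add_hodgeLaplacian_of_hodgeDecompositionSum`; middle degrees `…_middle`,
  extremes `…_zero`, `…_top`), from the three-term sum in degrees `k - 1`, `k`, `k + 1`:
  `α = η + dβ + δγ`, `dβ = dδγ₁`, `δγ = δdβ₂`
  (`exists_mextDeriv_eq_mextDeriv_mcoderiv_of_hodgeDecompositionSum`,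
  `exists_mcoderiv_eq_mcoderiv_mextDeriv_of_hodgeDecompositionSum`), and with
  `γ₁ = η₁ + dβ₁ + δγ₁'`, `β₂ = η₂ + dβ₂' + δγ₂` the form `w = dβ₁ + δγ₂` has `Δw = dβ + δγ`
  (`exists_isHarmonicForm_add_hodgeLaplacian_of_hodgeDecompositionSum_of_ranges`). The extreme
  neighbouring degrees are unconditional: `Ω⁰ = H⁰ + δΩ¹` (`exists_isHarmonicForm_add_mcoderiv_of_degree_zero`,
  by `⋆` from the harmonic representatives of top classes `exists_isHarmonicForm_mk_eq_top`, proved in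
  the tree by integration) and `Ωⁿ = Hⁿ + dΩⁿ⁻¹` (`exists_isHarmonicForm_add_mextDeriv_of_top`,
  `exists_mcoderiv_eq_mcoderiv_mextDeriv_of_top`).
* **Complex forms.** `Aᵏ_ℂ = ℋᵏ_ℂ + Δ_d(Aᵏ_ℂ)` by real and imaginary parts
  (`exists_isCHarmonicForm_add_cHodgeLaplacian_of_hodgeDecompositionSum`; Voisin, Thm. 5.23).
* **Kähler manifolds.** `A^{p,q} = ℋ^{p,q} + Δ_∂̄(A^{p,q})` in every bidegree
  (`exists_isDolbeaultHarmonic_add_dolbeaultLaplacian_of_hodgeDecompositionSum_of_kaehlerIdentity`):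
  take `(p,q)`-components of `α = η + Δ_d w` using `Δ_d = 2Δ_∂̄` and the bihomogeneity of `Δ_∂̄`
  (`dolbeaultLaplacian_typeComponent`; Voisin, Cor. 6.8–6.10). This is Thm. 5.24 (i) for `Δ_∂̄` on a
  Kähler manifold without the elliptic theory of `Δ_∂̄`.
* **Harmonic representatives.** `exists_isDolbeaultHarmonic_mk_eq_of_decomposition`: the Gilkey/Voisin
  argument of `exists_isDolbeaultHarmonic_mk_eq_of_regularity_of_compactness`
  (`KaehlerHodgeEllipticRepresentativeProofs.lean`) with the decomposition as its input;
  `finrank_dolbeaultHarmonicForms_eq_hodgeNumber_of_exists`: `dim_ℂ ℋ^{p,q} = h^{p,q}` by the class-map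
  bijection (uniqueness from `isDolbeaultHarmonic_rep_unique`).
* **Assembly.** `existsUnique_isDolbeaultHarmonic_mk_eq_of_hodgeDecompositionSum_of_kaehlerIdentity`
  (the Hodge theorem for `∂̄` on a compact Kähler manifold, every bidegree — the body of the C12
  predicate `existsUnique_isDolbeaultHarmonic_mk_eq g o` for a Kähler `g`),
  `finrank_dolbeaultHarmonicForms_eq_hodgeNumber_of_hodgeDecompositionSum_of_kaehlerIdentity`, and
  **`hodgeNumber_symm_of_isKaehlerManifold_of_hodgeDecompositionSum_of_kaehlerIdentity`** (with its
  `_of_compact` variant): the named fact from `h8` (Thm. 6.8 at every smooth metric and orientation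
  family of `M`) and `hK` (Thm. 6.7 likewise): for `p + q ≤ dim_ℝ M` by conjugation of harmonic
  forms (`dolbeaultHarmonicForms_conj_of_isManifold_complex_of_cHodgeLaplacian_eq_two_smul`,
  `finrank_map_conjₛₗ`), and beyond `dim_ℝ M` there are no forms.

The closed discharge, once the two upstream `_holds` exist, is
`hodgeNumber_symm_of_isKaehlerManifold_of_hodgeDecompositionSum_of_compact_of_kaehlerIdentity
(n := finrank ℝ E)` under `Fact.mk rfl`, fed
`fun g o _ _ k m ↦ harmonicForms_sup_exactSmoothForms_sup_span_mcoderiv_of_compact_holds 𝓘(ℝ, E) M o k m`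
and `fun g o ↦ cHodgeLaplacian_eq_two_smul_dolbeaultLaplacian_of_isManifold_complex_holds g o`.

## References

* C. Voisin, *Hodge Theory and Complex Algebraic Geometry I*, Cambridge Studies in Advanced
  Mathematics 76 (2002) (held; PDF pp. 111–112, 120–122): §5.3.1 Thm. 5.23 (proof:
  `A^k(X) = ℋ^k ⊕ Δ(A^k(X))`), Thm. 5.24; §6.1.2 Thm. 6.7, Cor. 6.8–6.10; §6.1.3 Prop. 6.11,
  Cor. 6.12, Prop. 6.17 (proof), Lemma 6.18. [cite: Voisin2002, §6.1.3 Cor. 6.12]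
* F. W. Warner, *Foundations of Differentiable Manifolds and Lie Groups*, GTM 94 (1983) (held; PDF
  pp. 197–201): 6.1, Prop. 6.2, Prop. 6.3, Thm. 6.8 (p. 223: the three lines of (1)), Thm. 6.11.
  [cite: WarnerGTM94, Thm. 6.8, p. 223]
* D. Huybrechts, *Complex Geometry. An Introduction*, Universitext (2005): Cor. 3.2.9, Cor. 3.2.12.
* P. B. Gilkey, *Invariance theory, the heat equation, and the Atiyah–Singer index theorem* (1995),
  Thm. 1.5.2 (proof).
-/

noncomputable section

open scoped Manifold ContDiff Topology ComplexConjugate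
open Bundle Module Set
open Literature.Geometry.Kaehler

namespace Literature.NumberTheory.Transcendental

/-! ### Real forms: `Ωᵏ = Hᵏ + Δ(Ωᵏ)` from Warner's three-term decomposition -/

section Real

open Literature.AlgebraicGeometry.Motives

variable {E : Type*} [NormedAddCommGroup E] [NormedSpace ℝ E] [FiniteDimensional ℝ E] {n : ℕ}
  [Fact (finrank ℝ E = n)] {H : Type*} [TopologicalSpace H] {I : ModelWithCorners ℝ E H}
  [I.Boundaryless] {M : Type*} [TopologicalSpace M] [ChartedSpace H M] [IsManifold I ∞ M]
  [T2Space M] [CompactSpace M] [RiemannianBundle (fun x : M ↦ TangentSpace I x)]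
  [IsContMDiffRiemannianBundle I ∞ E (fun x : M ↦ TangentSpace I x)]
  (o : (x : M) → Orientation ℝ (TangentSpace I x) (Fin n)) {k m : ℕ}

omit [I.Boundaryless] [T2Space M] [CompactSpace M] in
/-- Unpacking of Warner's three-term decomposition (Thm. 6.8, third line, sum half — the hodge.S08
predicate `harmonicForms_sup_exactSmoothForms_sup_span_mcoderiv I o` in degree `k + 1`): every smooth
`(k+1)`-form is `η + dβ + δγ` with `η` harmonic, `β` a smooth `k`-form and `γ` a smooth
`(k+2)`-form (the spans add nothing: `exists_eq_mextDeriv_of_mem_exactSmoothForms`,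
`exists_eq_mcoderiv_of_mem_span_mcoderiv`, `mem_harmonicForms_iff_of_contMDiffMetric`).
[cite: WarnerGTM94, Thm. 6.8, p. 223] -/
theorem exists_harmonic_add_exact_add_coexact_of_hodgeDecompositionSum
    (ho : IsSmoothForm (riemannianVolumeForm o)) (h : (k + 1) + (m + 1) = n)
    (h8 : harmonicForms_sup_exactSmoothForms_sup_span_mcoderiv (k := k) (m := m) I o)
    {α : MForm I M ℝ (k + 1)} (hα : IsSmoothForm α) :
    ∃ η : MForm I M ℝ (k + 1), IsHarmonicForm o h η ∧ ∃ β : MForm I M ℝ k, IsSmoothForm β ∧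
      ∃ γ : MForm I M ℝ (k + 1 + 1), IsSmoothForm γ ∧
        α = η + mextDeriv β + mcoderiv o (show (k + 1 + 1) + m = n by omega) γ := by
  have hmem : α ∈ smoothForms I M ℝ (k + 1) := hα
  rw [← h8 ho h] at hmem
  obtain ⟨y, hy, s, hs, hys⟩ := Submodule.mem_sup.1 hmem
  obtain ⟨η, hη, e, he, hηe⟩ := Submodule.mem_sup.1 hy
  have hηH : IsHarmonicForm o h η := (mem_harmonicForms_iff_of_contMDiffMetric o ho h η).1 hη
  obtain ⟨β, hβ, rfl⟩ := exists_eq_mextDeriv_of_mem_exactSmoothForms he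
  obtain ⟨γ, hγ, rfl⟩ := exists_eq_mcoderiv_of_mem_span_mcoderiv o ho _ hs
  exact ⟨η, hηH, β, hβ, γ, hγ, by rw [← hys, ← hηe]⟩

/-- **Degree `0`: `Ω⁰ = H⁰ + δ(Ω¹)`** on a compact oriented Riemannian manifold (Warner (1983),
Thm. 6.8 in degree `0`), unconditionally: for a smooth function `f`, the top form `⋆f` has a harmonic
representative `α` of its de Rham class (`exists_isHarmonicForm_mk_eq_top`, proved in the tree by
integration), `⋆f = α + dζ₀`; applying `⋆` back (`⋆⋆ = 1` on functions), `f = ⋆α + ⋆dζ₀` with `⋆α`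
harmonic (`IsHarmonicForm.hodgeStar`) and `⋆dζ₀ = ± δ(⋆ζ₀)` (`mcoderiv_hodgeStar`).
[cite: WarnerGTM94, Thm. 6.8, p. 223] -/
theorem exists_isHarmonicForm_add_mcoderiv_of_degree_zero
    (ho : IsSmoothForm (riemannianVolumeForm o)) (h : (0 + 1) + m = n)
    {f : MForm I M ℝ 0} (hf : IsSmoothForm f) :
    ∃ η : MForm I M ℝ 0, IsHarmonicForm o (show 0 + (m + 1) = n by omega) η ∧
      ∃ ζ : MForm I M ℝ (0 + 1), IsSmoothForm ζ ∧ f = η + mcoderiv o h ζ := by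
  obtain rfl : n = m + 1 := by omega
  have h0 : 0 + (m + 1) = m + 1 := by omega
  have h0' : (m + 1) + 0 = m + 1 := by omega
  -- the top form `⋆f` and a harmonic representative of its class
  have hγs : IsSmoothForm (MForm.hodgeStar o h0 f) := IsSmoothForm.hodgeStar o ho h0 hf
  have hγc : mextDeriv (MForm.hodgeStar o h0 f) = 0 := mextDeriv_eq_zero_of_top_degree _
  obtain ⟨α, hαH, hαc⟩ :=
    exists_isHarmonicForm_mk_eq_top o ho h0' (deRhamCohomology.mk ⟨MForm.hodgeStar o h0 f, hγs, hγc⟩)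
  have hex : MForm.hodgeStar o h0 f - (α : MForm I M ℝ (m + 1)) ∈ exactSmoothForms I M ℝ (m + 1) :=
    (deRhamCohomology.mk_eq_mk_iff ⟨MForm.hodgeStar o h0 f, hγs, hγc⟩ α).1 hαc.symm
  obtain ⟨ζ₀, hζ₀, hdζ₀⟩ := exists_eq_mextDeriv_of_mem_exactSmoothForms hex
  -- apply `⋆` back
  have hss := MForm.hodgeStar_hodgeStar_holds (o := o) (k := 0) (m := m + 1) h0 h0' f
  simp only [zero_mul, pow_zero, one_smul] at hss
  have hm1 : m + (0 + 1) = m + 1 := by omega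
  refine ⟨MForm.hodgeStar o h0' (α : MForm I M ℝ (m + 1)), hαH.hodgeStar o ho h0' h0,
    ((-1 : ℝ) ^ (m + 1)) • MForm.hodgeStar o hm1 ζ₀, (IsSmoothForm.hodgeStar o ho hm1 hζ₀).smul _, ?_⟩
  rw [mcoderiv_smul, mcoderiv_hodgeStar o hm1 h h0', smul_smul, ← mul_pow, neg_mul_neg, one_mul,
    one_pow, one_smul, hdζ₀, map_sub, add_sub_cancel, hss]

/-- **`d(Ωᵏ⁺¹) ⊆ dδ(Ωᵏ⁺²)` in the middle degrees**: if the three-term decomposition holds in degree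
`k + 1`, then for every smooth `(k+1)`-form `β`, `dβ = dδγ` for a smooth `(k+2)`-form `γ` — write
`β = η + dβ' + δγ` and use `dη = 0` (Warner, Prop. 6.3, `mextDeriv_eq_zero_of_isHarmonicForm`) and
`dd = 0`. A step of Warner's proof of Thm. 6.8 (p. 223: `d(E^{p-1}) = dδ(E^p)`).
[cite: WarnerGTM94, Thm. 6.8, p. 223] -/
theorem exists_mextDeriv_eq_mextDeriv_mcoderiv_of_hodgeDecompositionSum
    (ho : IsSmoothForm (riemannianVolumeForm o)) (h : (k + 1) + (m + 1) = n)
    (h8 : harmonicForms_sup_exactSmoothForms_sup_span_mcoderiv (k := k) (m := m) I o)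
    {β : MForm I M ℝ (k + 1)} (hβ : IsSmoothForm β) :
    ∃ γ : MForm I M ℝ (k + 1 + 1), IsSmoothForm γ ∧
      mextDeriv β = mextDeriv (mcoderiv o (show (k + 1 + 1) + m = n by omega) γ) := by
  obtain ⟨η, hη, β', hβ', γ, hγ, rfl⟩ :=
    exists_harmonic_add_exact_add_coexact_of_hodgeDecompositionSum o ho h h8 hβ
  refine ⟨γ, hγ, ?_⟩
  have hdβ' : IsSmoothForm (mextDeriv β') := hβ'.mextDeriv
  have hδγ : IsSmoothForm (mcoderiv o (show (k + 1 + 1) + m = n by omega) γ) :=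
    IsSmoothForm.mcoderiv o ho _ hγ
  rw [mextDeriv_add (hη.1.add hdβ') hδγ, mextDeriv_add hη.1 hdβ',
    Literature.AlgebraicGeometry.Motives.mextDeriv_eq_zero_of_isHarmonicForm o ho h hη,
    hβ'.mextDeriv_mextDeriv, zero_add, zero_add]

/-- **`d(Ω⁰) ⊆ dδ(Ω¹)`**: for a smooth function `β`, `dβ = dδζ` for a smooth `1`-form `ζ`
(`β = η + δζ` by `exists_isHarmonicForm_add_mcoderiv_of_degree_zero`, and harmonic functions are
closed). Warner (1983), proof of Thm. 6.8, p. 223, degree `0`. [cite: WarnerGTM94, Thm. 6.8, p. 223] -/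
theorem exists_mextDeriv_eq_mextDeriv_mcoderiv_of_degree_zero
    (ho : IsSmoothForm (riemannianVolumeForm o)) (h : (0 + 1) + m = n)
    {β : MForm I M ℝ 0} (hβ : IsSmoothForm β) :
    ∃ ζ : MForm I M ℝ (0 + 1), IsSmoothForm ζ ∧ mextDeriv β = mextDeriv (mcoderiv o h ζ) := by
  obtain ⟨η, hη, ζ, hζ, rfl⟩ := exists_isHarmonicForm_add_mcoderiv_of_degree_zero o ho h hβ
  refine ⟨ζ, hζ, ?_⟩
  rw [mextDeriv_add hη.1 (IsSmoothForm.mcoderiv o ho h hζ),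
    Literature.AlgebraicGeometry.Motives.mextDeriv_eq_zero_of_isHarmonicForm o ho _ hη]
  exact zero_add (mextDeriv (mcoderiv o h ζ))

/-- **`δ(Ωᵏ⁺¹) ⊆ δd(Ωᵏ)` in the middle degrees**: if the three-term decomposition holds in degree
`k + 1`, then for every smooth `(k+1)`-form `γ`, `δγ = δdβ` for a smooth `k`-form `β` — write
`γ = η + dβ + δγ'` and use `δη = 0` (Warner, Prop. 6.3, `mcoderiv_eq_zero_of_isHarmonicForm`) and
`δδ = 0` (`mcoderiv_mcoderiv_eq_zero`). A step of Warner's proof of Thm. 6.8 (p. 223: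
`δ(E^{p+1}) = δd(E^p)`). [cite: WarnerGTM94, Thm. 6.8, p. 223] -/
theorem exists_mcoderiv_eq_mcoderiv_mextDeriv_of_hodgeDecompositionSum
    (ho : IsSmoothForm (riemannianVolumeForm o)) (h : (k + 1) + (m + 1) = n)
    (h8 : harmonicForms_sup_exactSmoothForms_sup_span_mcoderiv (k := k) (m := m) I o)
    {γ : MForm I M ℝ (k + 1)} (hγ : IsSmoothForm γ) :
    ∃ β : MForm I M ℝ k, IsSmoothForm β ∧ mcoderiv o h γ = mcoderiv o h (mextDeriv β) := by
  obtain ⟨η, hη, β, hβ, γ', hγ', rfl⟩ :=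
    exists_harmonic_add_exact_add_coexact_of_hodgeDecompositionSum o ho h h8 hγ
  refine ⟨β, hβ, ?_⟩
  have hdβ : IsSmoothForm (mextDeriv β) := hβ.mextDeriv
  have hδγ' : IsSmoothForm (mcoderiv o (show (k + 1 + 1) + m = n by omega) γ') :=
    IsSmoothForm.mcoderiv o ho _ hγ'
  rw [mcoderiv_add o h (IsSmoothForm.hodgeStar o ho h (hη.1.add hdβ))
      (IsSmoothForm.hodgeStar o ho h hδγ'),
    mcoderiv_add o h (IsSmoothForm.hodgeStar o ho h hη.1) (IsSmoothForm.hodgeStar o ho h hdβ),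
    mcoderiv_eq_zero_of_isHarmonicForm o ho h hη, mcoderiv_mcoderiv_eq_zero o ho _ hγ', zero_add,
    add_zero]

/-- **Top degree: `Ωⁿ = Hⁿ + d(Ωⁿ⁻¹)`** on a compact oriented Riemannian manifold (Warner (1983),
Thm. 6.8 in degree `n`), unconditionally: a smooth top form `γ` is closed, and its de Rham class has a
harmonic representative `η` (`exists_isHarmonicForm_mk_eq_top`, proved in the tree by integration), so
`γ = η + dβ` with `β` smooth. [cite: WarnerGTM94, Thm. 6.8, p. 223] -/
theorem exists_isHarmonicForm_add_mextDeriv_of_top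
    (ho : IsSmoothForm (riemannianVolumeForm o)) (h : (k + 1) + 0 = n)
    {γ : MForm I M ℝ (k + 1)} (hγ : IsSmoothForm γ) :
    ∃ η : MForm I M ℝ (k + 1), IsHarmonicForm o h η ∧
      ∃ β : MForm I M ℝ k, IsSmoothForm β ∧ γ = η + mextDeriv β := by
  obtain rfl : n = k + 1 := by omega
  have hγc : mextDeriv γ = 0 := mextDeriv_eq_zero_of_top_degree _
  obtain ⟨α, hαH, hαc⟩ := exists_isHarmonicForm_mk_eq_top o ho h (deRhamCohomology.mk ⟨γ, hγ, hγc⟩)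
  have hex : γ - (α : MForm I M ℝ (k + 1)) ∈ exactSmoothForms I M ℝ (k + 1) :=
    (deRhamCohomology.mk_eq_mk_iff ⟨γ, hγ, hγc⟩ α).1 hαc.symm
  obtain ⟨β, hβ, hdβ⟩ := exists_eq_mextDeriv_of_mem_exactSmoothForms hex
  exact ⟨α, hαH, β, hβ, by rw [hdβ, add_sub_cancel]⟩

/-- **`δ(Ωⁿ) ⊆ δd(Ωⁿ⁻¹)`** (top degree, unconditionally): every smooth top form is `η + dβ` with `η`
harmonic (`exists_isHarmonicForm_add_mextDeriv_of_top`), so `δγ = δdβ` (`δη = 0`). Warner (1983),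
proof of Thm. 6.8, p. 223, degree `n`. [cite: WarnerGTM94, Thm. 6.8, p. 223] -/
theorem exists_mcoderiv_eq_mcoderiv_mextDeriv_of_top
    (ho : IsSmoothForm (riemannianVolumeForm o)) (h : (k + 1) + 0 = n)
    {γ : MForm I M ℝ (k + 1)} (hγ : IsSmoothForm γ) :
    ∃ β : MForm I M ℝ k, IsSmoothForm β ∧ mcoderiv o h γ = mcoderiv o h (mextDeriv β) := by
  obtain ⟨η, hη, β, hβ, rfl⟩ := exists_isHarmonicForm_add_mextDeriv_of_top o ho h hγ
  refine ⟨β, hβ, ?_⟩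
  rw [mcoderiv_add o h (IsSmoothForm.hodgeStar o ho h hη.1)
      (IsSmoothForm.hodgeStar o ho h hβ.mextDeriv),
    mcoderiv_eq_zero_of_isHarmonicForm o ho h hη, zero_add]

/-- **Warner's Theorem 6.8, first line from the third: `Ωᵏ⁺¹ = Hᵏ⁺¹ + Δ(Ωᵏ⁺¹)` in a middle
degree** `k + 1` (`(k + 1) + (m + 1) = n`), on a compact oriented Riemannian manifold with `C^∞`
metric. Hypotheses: the three-term decomposition `E^{k+1} = H^{k+1} + dE^k + δE^{k+2}` in degree
`k + 1` (`h8`, the hodge.S08 predicate), and the two range statements `d(E^k) ⊆ dδ(E^{k+1})` (`hd`)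
and `δ(E^{k+2}) ⊆ δd(E^{k+1})` (`hδ`) supplied by the neighbouring degrees
(`exists_mextDeriv_eq_mextDeriv_mcoderiv_of_hodgeDecompositionSum` / `…_of_degree_zero`,
`exists_mcoderiv_eq_mcoderiv_mextDeriv_of_hodgeDecompositionSum` / `…_of_top`). Proof: for `α` smooth,
`α = η + dβ + δγ` with `dβ = dδγ₁`, `δγ = δdβ₂`; decomposing `γ₁ = η₁ + dβ₁ + δγ₁'` and
`β₂ = η₂ + dβ₂' + δγ₂` gives `δγ₁ = δdβ₁`, `dβ₂ = dδγ₂`, and then `w = dβ₁ + δγ₂` has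
`Δw = dδw + δdw = dδdβ₁ + δdδγ₂ = dβ + δγ`, i.e. `α = η + Δw`. This is the passage between the lines
of Warner (1983), Thm. 6.8, p. 223 (`E^p = Δ(E^p) ⊕ H^p = dδ(E^p) ⊕ δd(E^p) ⊕ H^p =
d(E^{p-1}) ⊕ δ(E^{p+1}) ⊕ H^p`), run backwards. [cite: WarnerGTM94, Thm. 6.8, p. 223] -/
theorem exists_isHarmonicForm_add_hodgeLaplacian_of_hodgeDecompositionSum_of_ranges
    (ho : IsSmoothForm (riemannianVolumeForm o)) (h : (k + 1) + (m + 1) = n)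
    (h8 : harmonicForms_sup_exactSmoothForms_sup_span_mcoderiv (k := k) (m := m) I o)
    (hd : ∀ {β : MForm I M ℝ k}, IsSmoothForm β →
      ∃ γ : MForm I M ℝ (k + 1), IsSmoothForm γ ∧ mextDeriv β = mextDeriv (mcoderiv o h γ))
    (hδ : ∀ {γ : MForm I M ℝ (k + 1 + 1)}, IsSmoothForm γ →
      ∃ β : MForm I M ℝ (k + 1), IsSmoothForm β ∧
        mcoderiv o (show (k + 1 + 1) + m = n by omega) γ =
          mcoderiv o (show (k + 1 + 1) + m = n by omega) (mextDeriv β))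
    {α : MForm I M ℝ (k + 1)} (hα : IsSmoothForm α) :
    ∃ η : MForm I M ℝ (k + 1), IsHarmonicForm o h η ∧
      ∃ w : MForm I M ℝ (k + 1), IsSmoothForm w ∧ α = η + hodgeLaplacian o (k + 1) (m + 1) h w := by
  have h2 : (k + 1 + 1) + m = n := by omega
  obtain ⟨η, hη, β, hβ, γ, hγ, rfl⟩ :=
    exists_harmonic_add_exact_add_coexact_of_hodgeDecompositionSum o ho h h8 hα
  -- `dβ = dδγ₁`, `δγ = δdβ₂`
  obtain ⟨γ₁, hγ₁, hdβ⟩ := hd hβ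
  obtain ⟨β₂, hβ₂, hδγ⟩ := hδ hγ
  -- decompose `γ₁` and `β₂` in degree `k + 1`
  obtain ⟨η₁, hη₁, β₁, hβ₁, γ₁', hγ₁', rfl⟩ :=
    exists_harmonic_add_exact_add_coexact_of_hodgeDecompositionSum o ho h h8 hγ₁
  obtain ⟨η₂, hη₂, β₂', hβ₂', γ₂, hγ₂, rfl⟩ :=
    exists_harmonic_add_exact_add_coexact_of_hodgeDecompositionSum o ho h h8 hβ₂
  have hdβ₁ : IsSmoothForm (mextDeriv β₁) := hβ₁.mextDeriv
  have hδγ₁' : IsSmoothForm (mcoderiv o h2 γ₁') := IsSmoothForm.mcoderiv o ho h2 hγ₁'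
  have hdβ₂' : IsSmoothForm (mextDeriv β₂') := hβ₂'.mextDeriv
  have hδγ₂ : IsSmoothForm (mcoderiv o h2 γ₂) := IsSmoothForm.mcoderiv o ho h2 hγ₂
  -- `δγ₁ = δdβ₁`
  have e1 : mcoderiv o h (η₁ + mextDeriv β₁ + mcoderiv o h2 γ₁') = mcoderiv o h (mextDeriv β₁) := by
    rw [mcoderiv_add o h (IsSmoothForm.hodgeStar o ho h (hη₁.1.add hdβ₁))
        (IsSmoothForm.hodgeStar o ho h hδγ₁'),
      mcoderiv_add o h (IsSmoothForm.hodgeStar o ho h hη₁.1) (IsSmoothForm.hodgeStar o ho h hdβ₁),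
      mcoderiv_eq_zero_of_isHarmonicForm o ho h hη₁, mcoderiv_mcoderiv_eq_zero o ho h2 hγ₁',
      zero_add, add_zero]
  -- `dβ₂ = dδγ₂`
  have e2 : mextDeriv (η₂ + mextDeriv β₂' + mcoderiv o h2 γ₂) = mextDeriv (mcoderiv o h2 γ₂) := by
    rw [mextDeriv_add (hη₂.1.add hdβ₂') hδγ₂, mextDeriv_add hη₂.1 hdβ₂',
      Literature.AlgebraicGeometry.Motives.mextDeriv_eq_zero_of_isHarmonicForm o ho h hη₂,
      hβ₂'.mextDeriv_mextDeriv, zero_add, zero_add]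
  -- the candidate `w = dβ₁ + δγ₂`
  refine ⟨η, hη, mextDeriv β₁ + mcoderiv o h2 γ₂, hdβ₁.add hδγ₂, ?_⟩
  have hΔ : hodgeLaplacian o (k + 1) (m + 1) h (mextDeriv β₁ + mcoderiv o h2 γ₂) =
      mextDeriv (mcoderiv o h (mextDeriv β₁ + mcoderiv o h2 γ₂)) +
        mcoderiv o h2 (mextDeriv (mextDeriv β₁ + mcoderiv o h2 γ₂)) := rfl
  rw [hΔ, mcoderiv_add o h (IsSmoothForm.hodgeStar o ho h hdβ₁) (IsSmoothForm.hodgeStar o ho h hδγ₂),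
    mcoderiv_mcoderiv_eq_zero o ho h2 hγ₂, add_zero, mextDeriv_add hdβ₁ hδγ₂,
    hβ₁.mextDeriv_mextDeriv, zero_add, ← e1, ← hdβ, ← e2, ← hδγ, add_assoc]

/-- **Warner's Theorem 6.8, first line: `Ωᵏ⁺¹ = Hᵏ⁺¹ + Δ(Ωᵏ⁺¹)` in every middle degree**
`1 ≤ k + 1 ≤ n - 1`, on a compact oriented Riemannian manifold with `C^∞` metric, **from the sum
half of its third line** `E^p = H^p + dE^{p-1} + δE^{p+1}` in all middle degrees — the hodge.S08
named fact `harmonicForms_sup_exactSmoothForms_sup_span_mcoderiv I o` of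
`Literature/AlgebraicGeometry/Motives/HodgeTheorem.lean`, hypothesis `h8` — the extreme degrees
`0` and `n` being supplied unconditionally by `exists_mextDeriv_eq_mextDeriv_mcoderiv_of_degree_zero`
and `exists_mcoderiv_eq_mcoderiv_mextDeriv_of_top` (harmonic representatives of top classes,
`exists_isHarmonicForm_mk_eq_top`). Every smooth `(k+1)`-form is `η + Δw` with `η` harmonic and `w`
smooth. Warner (1983), Thm. 6.8, p. 223. [cite: WarnerGTM94, Thm. 6.8, p. 223] -/
theorem exists_isHarmonicForm_add_hodgeLaplacian_of_hodgeDecompositionSum_middle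
    (h8 : ∀ k' m', harmonicForms_sup_exactSmoothForms_sup_span_mcoderiv (k := k') (m := m') I o)
    (ho : IsSmoothForm (riemannianVolumeForm o)) (h : (k + 1) + (m + 1) = n)
    {α : MForm I M ℝ (k + 1)} (hα : IsSmoothForm α) :
    ∃ η : MForm I M ℝ (k + 1), IsHarmonicForm o h η ∧
      ∃ w : MForm I M ℝ (k + 1), IsSmoothForm w ∧ α = η + hodgeLaplacian o (k + 1) (m + 1) h w := by
  refine exists_isHarmonicForm_add_hodgeLaplacian_of_hodgeDecompositionSum_of_ranges o ho h (h8 k m)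
    (fun hβ ↦ ?_) (fun hγ ↦ ?_) hα
  · rcases k with - | k
    · exact exists_mextDeriv_eq_mextDeriv_mcoderiv_of_degree_zero o ho h hβ
    · exact exists_mextDeriv_eq_mextDeriv_mcoderiv_of_hodgeDecompositionSum o ho
        (show (k + 1) + (m + 1 + 1) = n by omega) (h8 k (m + 1)) hβ
  · rcases m with - | m
    · exact exists_mcoderiv_eq_mcoderiv_mextDeriv_of_top o ho (show (k + 1 + 1) + 0 = n by omega) hγ
    · exact exists_mcoderiv_eq_mcoderiv_mextDeriv_of_hodgeDecompositionSum o ho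
        (show (k + 1 + 1) + (m + 1) = n by omega) (h8 (k + 1) m) hγ

/-- **Warner's Theorem 6.8, first line, top degree: `Ωⁿ = Hⁿ + Δ(Ωⁿ)`** (`n = k + 1 ≥ 1`; here
`Δ = dδ`), from the three-term sum in degree `n - 1` (`h8`; for `n = 1` degree `0` is unconditional):
`α = η + dβ` (`exists_isHarmonicForm_add_mextDeriv_of_top`), `dβ = dδγ₁` (degree `n - 1`),
`γ₁ = η₁ + dβ₁`, so `δγ₁ = δdβ₁` and `α = η + dδdβ₁ = η + Δ(dβ₁)`. Warner (1983), Thm. 6.8, p. 223.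
[cite: WarnerGTM94, Thm. 6.8, p. 223] -/
theorem exists_isHarmonicForm_add_hodgeLaplacian_of_hodgeDecompositionSum_top
    (h8 : ∀ k' m', harmonicForms_sup_exactSmoothForms_sup_span_mcoderiv (k := k') (m := m') I o)
    (ho : IsSmoothForm (riemannianVolumeForm o)) (h : (k + 1) + 0 = n)
    {α : MForm I M ℝ (k + 1)} (hα : IsSmoothForm α) :
    ∃ η : MForm I M ℝ (k + 1), IsHarmonicForm o h η ∧
      ∃ w : MForm I M ℝ (k + 1), IsSmoothForm w ∧ α = η + hodgeLaplacian o (k + 1) 0 h w := by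
  obtain ⟨η, hη, β, hβ, rfl⟩ := exists_isHarmonicForm_add_mextDeriv_of_top o ho h hα
  -- `dβ = dδγ₁`
  obtain ⟨γ₁, hγ₁, hdβ⟩ : ∃ γ₁ : MForm I M ℝ (k + 1), IsSmoothForm γ₁ ∧
      mextDeriv β = mextDeriv (mcoderiv o h γ₁) := by
    rcases k with - | k
    · exact exists_mextDeriv_eq_mextDeriv_mcoderiv_of_degree_zero o ho h hβ
    · exact exists_mextDeriv_eq_mextDeriv_mcoderiv_of_hodgeDecompositionSum o ho
        (show (k + 1) + (0 + 1) = n by omega) (h8 k 0) hβ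
  -- `γ₁ = η₁ + dβ₁`, `δγ₁ = δdβ₁`
  obtain ⟨η₁, hη₁, β₁, hβ₁, rfl⟩ := exists_isHarmonicForm_add_mextDeriv_of_top o ho h hγ₁
  have hdβ₁ : IsSmoothForm (mextDeriv β₁) := hβ₁.mextDeriv
  refine ⟨η, hη, mextDeriv β₁, hdβ₁, ?_⟩
  have hΔ : hodgeLaplacian o (k + 1) 0 h (mextDeriv β₁) =
      mextDeriv (mcoderiv o h (mextDeriv β₁)) := rfl
  rw [hΔ, hdβ, mcoderiv_add o h (IsSmoothForm.hodgeStar o ho h hη₁.1)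
      (IsSmoothForm.hodgeStar o ho h hdβ₁),
    mcoderiv_eq_zero_of_isHarmonicForm o ho h hη₁, zero_add]

/-- **Warner's Theorem 6.8, first line, degree `0`: `Ω⁰ = H⁰ + Δ(Ω⁰)`** (`n = m + 1 ≥ 1`; here
`Δ = δd`), from the three-term sum in degree `1` (`h8`; for `n = 1` degree `1` is the top degree and
unconditional): `f = η + δζ` (`exists_isHarmonicForm_add_mcoderiv_of_degree_zero`), `δζ = δdβ`
(degree `1`), `β = η' + δζ'`, so `dβ = dδζ'` and `f = η + δdδζ' = η + Δ(δζ')`. Warner (1983),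
Thm. 6.8, p. 223. [cite: WarnerGTM94, Thm. 6.8, p. 223] -/
theorem exists_isHarmonicForm_add_hodgeLaplacian_of_hodgeDecompositionSum_zero
    (h8 : ∀ k' m', harmonicForms_sup_exactSmoothForms_sup_span_mcoderiv (k := k') (m := m') I o)
    (ho : IsSmoothForm (riemannianVolumeForm o)) (h : 0 + (m + 1) = n)
    {f : MForm I M ℝ 0} (hf : IsSmoothForm f) :
    ∃ η : MForm I M ℝ 0, IsHarmonicForm o h η ∧
      ∃ w : MForm I M ℝ 0, IsSmoothForm w ∧ f = η + hodgeLaplacian o 0 (m + 1) h w := by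
  have h1 : (0 + 1) + m = n := by omega
  obtain ⟨η, hη, ζ, hζ, rfl⟩ := exists_isHarmonicForm_add_mcoderiv_of_degree_zero o ho h1 hf
  -- `δζ = δdβ`
  obtain ⟨β, hβ, hδζ⟩ : ∃ β : MForm I M ℝ 0, IsSmoothForm β ∧
      mcoderiv o h1 ζ = mcoderiv o h1 (mextDeriv β) := by
    rcases m with - | m
    · exact exists_mcoderiv_eq_mcoderiv_mextDeriv_of_top o ho h1 hζ
    · exact exists_mcoderiv_eq_mcoderiv_mextDeriv_of_hodgeDecompositionSum o ho h1 (h8 0 m) hζ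
  -- `dβ = dδζ'`
  obtain ⟨ζ', hζ', hdβ⟩ := exists_mextDeriv_eq_mextDeriv_mcoderiv_of_degree_zero o ho h1 hβ
  refine ⟨η, hη, mcoderiv o h1 ζ', IsSmoothForm.mcoderiv o ho h1 hζ', ?_⟩
  have hΔ : hodgeLaplacian o 0 (m + 1) h (mcoderiv o h1 ζ') =
      mcoderiv o h1 (mextDeriv (mcoderiv o h1 ζ')) := rfl
  rw [hΔ, ← hdβ, ← hδζ]

/-- **Warner's Theorem 6.8, first line, in every degree: `Ωᵏ = Hᵏ + Δ(Ωᵏ)`** (`k + m = n`) on a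
compact oriented Riemannian manifold with `C^∞` metric, **from the sum half of its third line**
`E^p = H^p + dE^{p-1} + δE^{p+1}` in the middle degrees — the hodge.S08 named fact
`harmonicForms_sup_exactSmoothForms_sup_span_mcoderiv I o`, hypothesis `h8`. Every smooth `k`-form is
`η + Δw` with `η` harmonic and `w` smooth: middle degrees by `…_middle`, degree `0` by `…_zero`, top
degree by `…_top`, and for `n = 0` every smooth function is harmonic (`Δ = 0`). Warner (1983),
Thm. 6.8, p. 223 (`E^p(M) = Δ(E^p) ⊕ H^p`). [cite: WarnerGTM94, Thm. 6.8, p. 223] -/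
theorem exists_isHarmonicForm_add_hodgeLaplacian_of_hodgeDecompositionSum
    (h8 : ∀ k' m', harmonicForms_sup_exactSmoothForms_sup_span_mcoderiv (k := k') (m := m') I o)
    (ho : IsSmoothForm (riemannianVolumeForm o)) (h : k + m = n)
    {α : MForm I M ℝ k} (hα : IsSmoothForm α) :
    ∃ η : MForm I M ℝ k, IsHarmonicForm o h η ∧
      ∃ w : MForm I M ℝ k, IsSmoothForm w ∧ α = η + hodgeLaplacian o k m h w := by
  rcases k with - | k <;> rcases m with - | m
  · exact ⟨α, ⟨hα, rfl⟩, 0, isSmoothForm_zero, by simp [hodgeLaplacian]⟩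
  · exact exists_isHarmonicForm_add_hodgeLaplacian_of_hodgeDecompositionSum_zero o h8 ho h hα
  · exact exists_isHarmonicForm_add_hodgeLaplacian_of_hodgeDecompositionSum_top o h8 ho h hα
  · exact exists_isHarmonicForm_add_hodgeLaplacian_of_hodgeDecompositionSum_middle o h8 ho h hα

end Real

/-! ### Complex forms: `Aᵏ_ℂ = ℋᵏ_ℂ + Δ_d(Aᵏ_ℂ)` by complexification -/

section Complex

open Literature.AlgebraicGeometry.Motives

variable {E : Type*} [NormedAddCommGroup E] [NormedSpace ℂ E] [FiniteDimensional ℂ E] {n : ℕ}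
  [Fact (finrank ℝ E = n)] {M : Type*} [TopologicalSpace M] [ChartedSpace E M]
  [IsManifold 𝓘(ℝ, E) ∞ M] [T2Space M] [CompactSpace M]
  [RiemannianBundle (fun x : M ↦ TangentSpace 𝓘(ℝ, E) x)]
  [IsContMDiffRiemannianBundle 𝓘(ℝ, E) ∞ E (fun x : M ↦ TangentSpace 𝓘(ℝ, E) x)]
  (o : (x : M) → Orientation ℝ (TangentSpace 𝓘(ℝ, E) x) (Fin n)) {k m : ℕ}

/-- **`Aᵏ_ℂ = ℋᵏ_ℂ + Δ_d(Aᵏ_ℂ)` in every degree, complex coefficients**: every smooth complex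
`k`-form is `η + Δ_d w` with `η` `Δ_d`-harmonic (`IsCHarmonicForm`) and `w` smooth, from the real
statement `exists_isHarmonicForm_add_hodgeLaplacian_of_hodgeDecompositionSum` applied to the real and
imaginary parts (the complexified Laplacian is the `ℂ`-linear extension of the real one,
`cHodgeLaplacian_ofReal_holds`, `isCHarmonicForm_iff_re_im`). Hypothesis `h8`: Warner's Thm. 6.8
(third line, sum half) in every middle degree, the hodge.S08 predicate. Voisin (2002), Thm. 5.23 (the
complex-coefficient Hodge theorem is the real one tensored with `ℂ`); Warner (1983), Thm. 6.8.
[cite: WarnerGTM94, Thm. 6.8, p. 223] -/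
theorem exists_isCHarmonicForm_add_cHodgeLaplacian_of_hodgeDecompositionSum
    (h8 : ∀ k' m', harmonicForms_sup_exactSmoothForms_sup_span_mcoderiv (k := k') (m := m') 𝓘(ℝ, E) o)
    (ho : IsSmoothForm (riemannianVolumeForm o)) (h : k + m = n)
    {α : MForm 𝓘(ℝ, E) M ℂ k} (hα : IsSmoothForm α) :
    ∃ η : MForm 𝓘(ℝ, E) M ℂ k, IsCHarmonicForm o h η ∧
      ∃ w : MForm 𝓘(ℝ, E) M ℂ k, IsSmoothForm w ∧ α = η + cHodgeLaplacian o k m h w := by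
  obtain ⟨η₁, hη₁, w₁, hw₁, e₁⟩ :=
    exists_isHarmonicForm_add_hodgeLaplacian_of_hodgeDecompositionSum o h8 ho h hα.re
  obtain ⟨η₂, hη₂, w₂, hw₂, e₂⟩ :=
    exists_isHarmonicForm_add_hodgeLaplacian_of_hodgeDecompositionSum o h8 ho h hα.im
  have hre : (η₁.ofReal + Complex.I • η₂.ofReal).re = η₁ := by
    rw [MForm.re_add, MForm.re_ofReal, MForm.re_smul]; simp
  have him : (η₁.ofReal + Complex.I • η₂.ofReal).im = η₂ := by
    rw [MForm.im_add, MForm.im_ofReal, MForm.im_smul]; simp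
  refine ⟨η₁.ofReal + Complex.I • η₂.ofReal,
    (isCHarmonicForm_iff_re_im o ho h _).2 ⟨by rw [hre]; exact hη₁, by rw [him]; exact hη₂⟩,
    w₁.ofReal + Complex.I • w₂.ofReal, hw₁.ofReal.add (hw₂.ofReal.smul_complex _), ?_⟩
  rw [cHodgeLaplacian_add o ho h hw₁.ofReal (hw₂.ofReal.smul_complex _), cHodgeLaplacian_smul,
    cHodgeLaplacian_ofReal_holds o h w₁, cHodgeLaplacian_ofReal_holds o h w₂]
  conv_lhs => rw [← α.ofReal_re_add_I_smul_ofReal_im, e₁, e₂]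
  rw [MForm.ofReal_add, MForm.ofReal_add, smul_add]
  abel

end Complex

/-! ### Kähler manifolds: `A^{p,q} = ℋ^{p,q} + Δ_∂̄(A^{p,q})` from `Δ_d = 2Δ_∂̄` -/

section Kaehler

open Literature.AlgebraicGeometry.Motives

variable {E : Type*} [NormedAddCommGroup E] [NormedSpace ℂ E] [FiniteDimensional ℂ E] {n : ℕ}
  [Fact (finrank ℝ E = n)] {M : Type*} [TopologicalSpace M] [ChartedSpace E M]
  [IsManifold 𝓘(ℂ, E) ω M] [IsManifold 𝓘(ℝ, E) ∞ M] [T2Space M] [CompactSpace M]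
  (g : ContMDiffRiemannianMetric 𝓘(ℝ, E) ∞ E (fun x : M ↦ TangentSpace 𝓘(ℝ, E) x))
  (o : (x : M) → Orientation ℝ (TangentSpace 𝓘(ℝ, E) x) (Fin n)) {k m : ℕ}

/-- **`A^{p,q} = ℋ^{p,q} + Δ_∂̄(A^{p,q})` on a compact Kähler manifold, in every bidegree
`p + q = k`, from Warner's Theorem 6.8 and the Kähler identity `Δ_d = 2Δ_∂̄`** — this is part (i)
of the Hodge theorem for `Δ_∂̄` (Voisin (2002), Thm. 5.24 (i) / Thm. 5.22 (i): `A^{p,q} = ℋ^{p,q} ⊕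
Δ_∂̄(A^{p,q})`), obtained here *without the elliptic theory of `Δ_∂̄`*: for the smooth Kähler metric
`g` (`hg`) and an orientation family `o` with smooth volume form (`ho`), assume Warner's three-term
decomposition for the Riemannian metric of `g` in every middle degree (`h8`, hodge.S08) and the
corrected Kähler identity `cHodgeLaplacian_eq_two_smul_dolbeaultLaplacian_of_isManifold_complex g o` in
degree `k` (`hK`, Voisin, Thm. 6.7). Then a smooth `(p,q)`-form `α` is `η + Δ_d w` with `η`
`Δ_d`-harmonic and `w` smooth (`exists_isCHarmonicForm_add_cHodgeLaplacian_of_hodgeDecompositionSum`);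
taking `(p,q)`-components, `α = η^{p,q} + (2Δ_∂̄ w)^{p,q} = η^{p,q} + Δ_∂̄(2w^{p,q})` since `Δ_∂̄` is
bihomogeneous (`dolbeaultLaplacian_typeComponent`, Voisin, Cor. 6.8–6.9), and `η^{p,q}` is smooth
(holomorphic atlas), of type `(p,q)`, with `Δ_∂̄ η^{p,q} = (Δ_∂̄ η)^{p,q} = (½Δ_d η)^{p,q} = 0`, i.e.
`η^{p,q} ∈ ℋ^{p,q}` (Voisin, Cor. 6.10). [cite: Voisin2002, Thm. 5.24 (i); §6.1.2 Thm. 6.7, Cor. 6.9] -/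
theorem exists_isDolbeaultHarmonic_add_dolbeaultLaplacian_of_hodgeDecompositionSum_of_kaehlerIdentity
    (h8 : ∀ k' m', letI : RiemannianBundle (fun x : M ↦ TangentSpace 𝓘(ℝ, E) x) := ⟨g.toRiemannianMetric⟩
      harmonicForms_sup_exactSmoothForms_sup_span_mcoderiv (k := k') (m := m') 𝓘(ℝ, E) o)
    (hK : cHodgeLaplacian_eq_two_smul_dolbeaultLaplacian_of_isManifold_complex (k := k) (m := m) g o)
    (hg : g.toRiemannianMetric.IsKaehler) {p q : ℕ} (hpq : p + q = k) (h : k + m = n)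
    (ho : letI : RiemannianBundle (fun x : M ↦ TangentSpace 𝓘(ℝ, E) x) := ⟨g.toRiemannianMetric⟩
      IsSmoothForm (riemannianVolumeForm o))
    {α : MForm 𝓘(ℝ, E) M ℂ k} (hα : IsSmoothForm α) (ht : IsOfType p q α) :
    letI : RiemannianBundle (fun x : M ↦ TangentSpace 𝓘(ℝ, E) x) := ⟨g.toRiemannianMetric⟩
    ∃ η w : MForm 𝓘(ℝ, E) M ℂ k, IsDolbeaultHarmonic o p q h η ∧ IsSmoothForm w ∧
      IsOfType p q w ∧ α = η + dolbeaultLaplacian o k m h w := by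
  letI : RiemannianBundle (fun x : M ↦ TangentSpace 𝓘(ℝ, E) x) := ⟨g.toRiemannianMetric⟩
  haveI : IsContMDiffRiemannianBundle 𝓘(ℝ, E) ∞ E (fun x : M ↦ TangentSpace 𝓘(ℝ, E) x) :=
    ⟨g.inner, g.contMDiff, fun _ _ _ ↦ rfl⟩
  have hH : ∀ (x : M) (v w : TangentSpace 𝓘(ℝ, E) x),
      inner ℝ (tangentJ E x v) (tangentJ E x w) = inner ℝ v w := fun x v w ↦ hg.isHermitian x v w
  obtain ⟨η, hη, w, hw, e⟩ :=
    exists_isCHarmonicForm_add_cHodgeLaplacian_of_hodgeDecompositionSum o h8 ho h hα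
  -- `Δ_∂̄ η = 0`
  have hΔη : dolbeaultLaplacian o k m h η = 0 := by
    have h2 := hK hg h hη.1 ho
    rw [hη.2] at h2
    exact (smul_eq_zero_iff_right two_ne_zero).mp h2.symm
  refine ⟨η.typeComponent p q, (2 : ℂ) • w.typeComponent p q,
    ⟨hη.1.typeComponent p q, isOfType_typeComponent_holds hpq _, ?_⟩,
    (hw.typeComponent p q).smul_complex _, (isOfType_typeComponent_holds hpq _).smul _, ?_⟩
  · rw [dolbeaultLaplacian_typeComponent o hH h p q η, hΔη, MForm.typeComponent_zero]
  · rw [dolbeaultLaplacian_smul, dolbeaultLaplacian_typeComponent o hH h p q w,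
      ← MForm.typeComponent_smul, ← hK hg h hw ho, ← MForm.typeComponent_add, ← e,
      ht.typeComponent_eq_self]

end Kaehler

/-! ### Harmonic representatives of Dolbeault classes from the decomposition -/

section Representatives

variable {E : Type*} [NormedAddCommGroup E] [NormedSpace ℂ E] [FiniteDimensional ℂ E] {n : ℕ}
  [Fact (finrank ℝ E = n)] {M : Type*} [TopologicalSpace M] [ChartedSpace E M]
  [IsManifold 𝓘(ℂ, E) ω M] [IsManifold 𝓘(ℝ, E) ∞ M]
  [RiemannianBundle (fun x : M ↦ TangentSpace 𝓘(ℝ, E) x)]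
  (o : (x : M) → Orientation ℝ (TangentSpace 𝓘(ℝ, E) x) (Fin n)) {m : ℕ}
  [MeasurableSpace E] [BorelSpace E] [T2Space M] [CompactSpace M]
  [IsContinuousRiemannianBundle E (fun x : M ↦ TangentSpace 𝓘(ℝ, E) x)]
  [IsContMDiffRiemannianBundle 𝓘(ℝ, E) ∞ E (fun x : M ↦ TangentSpace 𝓘(ℝ, E) x)]
  [Fact (IsSmoothForm (riemannianVolumeForm o))]

/-- **Existence of a `Δ_∂̄`-harmonic representative in every Dolbeault class `H^{p,q}_{∂̄}`, from
the decomposition `A^{p,q} = ℋ^{p,q} + Δ_∂̄(A^{p,q})`** (hypothesis `hD`, needed only for `q ≥ 1`), on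
a compact complex manifold with a smooth Hermitian metric (instance form `hJ`) and `vol_o` smooth (as
a `Fact`). This is the argument of `exists_isDolbeaultHarmonic_mk_eq_of_regularity_of_compactness`
(`KaehlerHodgeEllipticRepresentativeProofs.lean`; Voisin (2002), Thm. 5.24 ⇒ §5.3.1; Gilkey (1995),
proof of Thm. 1.5.2) with its analytic input replaced by the decomposition itself: for `q = 0` a
`∂̄`-closed `(p,0)`-form is harmonic; for `q ≥ 1`, `α = η + Δ_∂̄ w = η + ∂̄∂̄*w + ∂̄*∂̄w` with
`θ = ∂̄*∂̄w` `∂̄`-closed, hence `‖θ‖² = ⟪∂̄w, ∂̄θ⟫ = 0`, so `α - η = ∂̄(∂̄*w)` is `∂̄`-exact.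
[cite: Voisin2002, Thm. 5.24] -/
theorem exists_isDolbeaultHarmonic_mk_eq_of_decomposition
    (hJ : ∀ (x : M) (v w : TangentSpace 𝓘(ℝ, E) x),
      inner ℝ (tangentJ E x v) (tangentJ E x w) = inner ℝ v w)
    {p q : ℕ} (h : (p + q) + m = n)
    (hD : 0 < q → ∀ {α : MForm 𝓘(ℝ, E) M ℂ (p + q)}, IsSmoothForm α → IsOfType p q α →
      ∃ η w : MForm 𝓘(ℝ, E) M ℂ (p + q), IsDolbeaultHarmonic o p q h η ∧ IsSmoothForm w ∧
        IsOfType p q w ∧ α = η + dolbeaultLaplacian o (p + q) m h w)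
    (c : dolbeaultCohomology E M p q) :
    ∃ η : dolbeaultClosedForms E M p q,
      IsDolbeaultHarmonic o p q h (η : MForm 𝓘(ℝ, E) M ℂ (p + q)) ∧
        dolbeaultCohomology.mk E M p q η = c := by
  have ho : IsSmoothForm (riemannianVolumeForm o) := Fact.out
  obtain ⟨α₀, rfl⟩ := dolbeaultCohomology.mk_surjective c
  obtain ⟨hαs, hαt, hαd⟩ := (mem_dolbeaultClosedForms_iff (E := E) (M := M)
    isSmoothForm_typeComponent_holds dolbeaultBar_smul_holds (α₀ : MForm 𝓘(ℝ, E) M ℂ (p + q))).1 α₀.2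
  -- it suffices to find a harmonic `η` with `α₀ - η` exact
  suffices H : ∃ η : MForm 𝓘(ℝ, E) M ℂ (p + q), IsDolbeaultHarmonic o p q h η ∧
      (α₀ : MForm 𝓘(ℝ, E) M ℂ (p + q)) - η ∈ dolbeaultExactForms E M p q by
    obtain ⟨η, hη, hex⟩ := H
    refine ⟨⟨η, mem_dolbeaultClosedForms hη.1 hη.2.1 (hη.dolbeaultBar_eq_zero o hJ ho h)⟩, hη, ?_⟩
    rw [dolbeaultCohomology.mk_eq_mk_iff]
    simpa using Submodule.neg_mem _ hex
  rcases q with - | q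
  · -- `q = 0`: `α₀` itself is harmonic
    exact ⟨α₀, isDolbeaultHarmonic_of_dolbeaultBar_eq_zero_of_type_zero o hJ h hαs hαt hαd, by simp⟩
  · -- `q ≥ 1`: decompose `α₀ = η + Δ w`
    obtain ⟨η, w, hη, hws, hwt, hdec⟩ := hD (Nat.succ_pos q) hαs hαt
    refine ⟨η, hη, ?_⟩
    have h1 : (p + q + 1) + m = n := by omega
    -- `∂̄* w ∈ A^{p,q}` and `∂̄(∂̄* w)` is exact
    have hBs : IsSmoothForm (dolbeaultBarAdjoint o h1 w) := IsSmoothForm.dolbeaultBarAdjoint o ho h1 hws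
    have hBt : IsOfType p q (dolbeaultBarAdjoint o h1 w) := hwt.dolbeaultBarAdjoint o hJ h1
    have hexact : dolbeaultBar (dolbeaultBarAdjoint o h1 w) ∈ dolbeaultExactForms E M p (q + 1) :=
      dolbeaultBar_mem_dolbeaultExactForms ((mem_pqForms_iff _).2 ⟨hBs, hBt⟩)
    -- it remains to see `α₀ - η = ∂̄(∂̄* w)`, i.e. `Δ w = ∂̄(∂̄* w)`
    suffices hΔ : dolbeaultLaplacian o (p + (q + 1)) m h w = dolbeaultBar (dolbeaultBarAdjoint o h1 w) by
      rw [hdec, add_sub_cancel_left, hΔ]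
      exact hexact
    rcases m with - | m
    · -- top degree: `Δ w = ∂̄ ∂̄* w` by definition
      rfl
    · -- generic degree: `Δ w = ∂̄∂̄*w + ∂̄*∂̄w` and `θ = ∂̄*∂̄w = 0`
      have h2 : (p + q + 1 + 1) + m = n := by omega
      have hΔdef : dolbeaultLaplacian o (p + (q + 1)) (m + 1) h w =
          dolbeaultBar (dolbeaultBarAdjoint o h1 w) + dolbeaultBarAdjoint o h2 (dolbeaultBar w) := rfl
      have hdws : IsSmoothForm (dolbeaultBar w) := hws.dolbeaultBar
      have hθs : IsSmoothForm (dolbeaultBarAdjoint o h2 (dolbeaultBar w)) :=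
        IsSmoothForm.dolbeaultBarAdjoint o ho h2 hdws
      -- `∂̄θ = 0` for `θ = ∂̄*∂̄w`: apply `∂̄` to `α₀ = η + ∂̄∂̄*w + θ`
      have hdθ : dolbeaultBar (dolbeaultBarAdjoint o h2 (dolbeaultBar w)) = 0 := by
        have hdη : dolbeaultBar η = 0 := hη.dolbeaultBar_eq_zero o hJ ho h
        have hdd : dolbeaultBar (dolbeaultBar (dolbeaultBarAdjoint o h1 w)) = 0 :=
          dolbeaultBar_dolbeaultBar_holds hBs
        have := congrArg dolbeaultBar hdec
        rw [hΔdef, hαd, dolbeaultBar_add' hη.1 (hBs.dolbeaultBar.add hθs),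
          dolbeaultBar_add' hBs.dolbeaultBar hθs, hdη, hdd, zero_add, zero_add] at this
        exact this.symm
      -- `⟪θ, θ⟫ = ⟪∂̄w, ∂̄θ⟫ = 0`, so `θ = 0`
      have hθ0 : dolbeaultBarAdjoint o h2 (dolbeaultBar w) = 0 := by
        have h0 : MForm.cl2Inner o (dolbeaultBarAdjoint o h2 (dolbeaultBar w))
            (dolbeaultBarAdjoint o h2 (dolbeaultBar w)) = 0 := by
          rw [cl2Inner_dolbeaultBarAdjoint_left_of_isHermitian o hJ ho h2 hθs hdws, hdθ,
            MForm.cl2Inner_zero_right]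
        exact eq_zero_of_cl2Inner_self_eq_zero o ho h1 hθs h0
      rw [hΔdef, hθ0, add_zero]

/-- **`dim_ℂ ℋ^{p,q} = h^{p,q}` from existence and uniqueness of harmonic representatives** in the
bidegree `(p,q)` (compact complex manifold, smooth Hermitian metric in the instance form `hJ`, `vol_o`
smooth): the class map `ℋ^{p,q} → H^{p,q}_{∂̄}`, `α ↦ [α]` — defined since `ℋ^{p,q} ≤ Z^{p,q}_{∂̄}`
(`dolbeaultHarmonicForms_le_dolbeaultClosedForms_of_inner_tangentJ`, Voisin (2002), Cor. 5.13) — is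
surjective by existence (`hE`) and injective by uniqueness (`isDolbeaultHarmonic_rep_unique`), hence
a linear equivalence. The bidegree-wise form of `finrank_dolbeaultHarmonicForms_eq_hodgeNumber_of_existsUnique`
(`KaehlerHodgeSymmAssemblyProofs.lean`). Voisin (2002), §5.3.1, Thm. 5.24; Huybrechts (2005),
Cor. 3.2.9. [cite: Voisin2002, Thm. 5.24] -/
theorem finrank_dolbeaultHarmonicForms_eq_hodgeNumber_of_exists
    (hJ : ∀ (x : M) (v w : TangentSpace 𝓘(ℝ, E) x),
      inner ℝ (tangentJ E x v) (tangentJ E x w) = inner ℝ v w)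
    {p q : ℕ} (h : (p + q) + m = n)
    (hE : ∀ c : dolbeaultCohomology E M p q, ∃ η : dolbeaultClosedForms E M p q,
      IsDolbeaultHarmonic o p q h (η : MForm 𝓘(ℝ, E) M ℂ (p + q)) ∧ dolbeaultCohomology.mk E M p q η = c) :
    finrank ℂ ↥(dolbeaultHarmonicForms o p q h) = hodgeNumber E M p q := by
  have ho : IsSmoothForm (riemannianVolumeForm o) := Fact.out
  have hZ : dolbeaultHarmonicForms o p q h ≤ dolbeaultClosedForms E M p q :=
    dolbeaultHarmonicForms_le_dolbeaultClosedForms_of_inner_tangentJ o hJ ho h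
  -- elements of the span `ℋ^{p,q}` are `∂̄`-harmonic `(p,q)`-forms
  have hmem : ∀ a : ↥(dolbeaultHarmonicForms o p q h),
      IsDolbeaultHarmonic o p q h (a : MForm 𝓘(ℝ, E) M ℂ (p + q)) := fun a ↦
    (mem_dolbeaultHarmonicForms_iff_of_contMDiffMetric o ho rfl h _).1 a.2
  -- the class map `ℋ^{p,q} → H^{p,q}`
  let φ : ↥(dolbeaultHarmonicForms o p q h) →ₗ[ℂ] dolbeaultCohomology E M p q :=
    (dolbeaultCohomology.mk E M p q).comp (Submodule.inclusion hZ)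
  have hφ : ∀ a, φ a = dolbeaultCohomology.mk E M p q (Submodule.inclusion hZ a) := fun _ ↦ rfl
  have hinj : Function.Injective φ := by
    intro a b hab
    exact Submodule.inclusion_injective hZ
      (isDolbeaultHarmonic_rep_unique o hJ ho h (hmem a) (hmem b) (by rw [← hφ, ← hφ, hab]))
  have hsurj : Function.Surjective φ := by
    intro c
    obtain ⟨γ, hγ, hγc⟩ := hE c
    exact ⟨⟨(γ : MForm 𝓘(ℝ, E) M ℂ (p + q)), hγ.mem_dolbeaultHarmonicForms⟩, hγc⟩
  rw [hodgeNumber]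
  exact (LinearEquiv.ofBijective φ ⟨hinj, hsurj⟩).finrank_eq

end Representatives

/-! ### Assembly: the Hodge theorem for `∂̄` on a compact Kähler manifold, and Hodge symmetry -/

section Assembly

open Literature.AlgebraicGeometry.Motives

variable {E : Type*} [NormedAddCommGroup E] [NormedSpace ℂ E] [FiniteDimensional ℂ E] {n : ℕ}
  [Fact (finrank ℝ E = n)] {M : Type*} [TopologicalSpace M] [ChartedSpace E M]
  [IsManifold 𝓘(ℂ, E) ω M] [IsManifold 𝓘(ℝ, E) ∞ M]

omit [IsManifold 𝓘(ℂ, E) ω M] [IsManifold 𝓘(ℝ, E) ∞ M] in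
/-- Transport of `finrank ℋ^{p,q}` along an equality of ambient degrees (the harmonic space of
type `(q,p)` is needed both inside the `(p+q)`-forms and inside the `(q+p)`-forms). [folklore] -/
theorem finrank_dolbeaultHarmonicForms_congr_deg
    [RiemannianBundle (fun x : M ↦ TangentSpace 𝓘(ℝ, E) x)]
    (o : (x : M) → Orientation ℝ (TangentSpace 𝓘(ℝ, E) x) (Fin n)) {p q k k' m : ℕ}
    (e : k = k') (h : k + m = n) (h' : k' + m = n) :
    finrank ℂ ↥(dolbeaultHarmonicForms o p q h) = finrank ℂ ↥(dolbeaultHarmonicForms o p q h') := by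
  subst e
  rfl

variable (g : ContMDiffRiemannianMetric 𝓘(ℝ, E) ∞ E (fun x : M ↦ TangentSpace 𝓘(ℝ, E) x))
  (o : (x : M) → Orientation ℝ (TangentSpace 𝓘(ℝ, E) x) (Fin n))

/-- **The Hodge theorem for `∂̄` on a compact Kähler manifold, from Warner's Theorem 6.8 and the
Kähler identity** (Voisin (2002), Thm. 5.24 / §5.3.1 in the Kähler case): for the smooth Kähler
metric `g` on the compact complex manifold `M` and an orientation family `o` with smooth volume form,
every Dolbeault class `c ∈ H^{p,q}_{∂̄}(M)` (`(p + q) + m = n`) has a unique `Δ_∂̄`-harmonic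
representative — assuming Warner's three-term decomposition for the Riemannian
metric of `g` in every middle degree (`h8`, the hodge.S08 named fact
`harmonicForms_sup_exactSmoothForms_sup_span_mcoderiv 𝓘(ℝ, E) o`; Warner (1983), Thm. 6.8) and the
corrected Kähler identity `cHodgeLaplacian_eq_two_smul_dolbeaultLaplacian_of_isManifold_complex g o` in
every degree (`hK`; Voisin (2002), Thm. 6.7). Existence:
`exists_isDolbeaultHarmonic_mk_eq_of_decomposition` fed
`exists_isDolbeaultHarmonic_add_dolbeaultLaplacian_of_hodgeDecompositionSum_of_kaehlerIdentity`;
uniqueness: `isDolbeaultHarmonic_rep_unique`. On a Kähler manifold this replaces the elliptic theory of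
`Δ_∂̄` (Voisin, Thm. 5.22) by that of `Δ_d` (Warner, Thms. 6.5–6.6, behind `h8`).
[cite: Voisin2002, Thm. 5.24; §6.1.2 Thm. 6.7] -/
theorem existsUnique_isDolbeaultHarmonic_mk_eq_of_hodgeDecompositionSum_of_kaehlerIdentity
    [CompactSpace M] [T2Space M]
    (h8 : ∀ k m, letI : RiemannianBundle (fun x : M ↦ TangentSpace 𝓘(ℝ, E) x) := ⟨g.toRiemannianMetric⟩
      harmonicForms_sup_exactSmoothForms_sup_span_mcoderiv (k := k) (m := m) 𝓘(ℝ, E) o)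
    (hK : ∀ {k m : ℕ},
      cHodgeLaplacian_eq_two_smul_dolbeaultLaplacian_of_isManifold_complex (k := k) (m := m) g o)
    (hg : g.toRiemannianMetric.IsKaehler) {p q m : ℕ} (h : (p + q) + m = n)
    (ho : letI : RiemannianBundle (fun x : M ↦ TangentSpace 𝓘(ℝ, E) x) := ⟨g.toRiemannianMetric⟩
      IsSmoothForm (riemannianVolumeForm o))
    (c : dolbeaultCohomology E M p q) :
    letI : RiemannianBundle (fun x : M ↦ TangentSpace 𝓘(ℝ, E) x) := ⟨g.toRiemannianMetric⟩
    ∃! α : dolbeaultClosedForms E M p q,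
      IsDolbeaultHarmonic o p q h (α : MForm 𝓘(ℝ, E) M ℂ (p + q)) ∧
        dolbeaultCohomology.mk E M p q α = c := by
  letI : RiemannianBundle (fun x : M ↦ TangentSpace 𝓘(ℝ, E) x) := ⟨g.toRiemannianMetric⟩
  haveI : IsContMDiffRiemannianBundle 𝓘(ℝ, E) ∞ E (fun x : M ↦ TangentSpace 𝓘(ℝ, E) x) :=
    ⟨g.inner, g.contMDiff, fun _ _ _ ↦ rfl⟩
  haveI : IsContinuousRiemannianBundle E (fun x : M ↦ TangentSpace 𝓘(ℝ, E) x) :=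
    ⟨g.inner, g.contMDiff.continuous, fun _ _ _ ↦ rfl⟩
  letI : MeasurableSpace E := borel E
  haveI : BorelSpace E := ⟨rfl⟩
  haveI : Fact (IsSmoothForm (riemannianVolumeForm o)) := ⟨ho⟩
  have hJ : ∀ (x : M) (v w : TangentSpace 𝓘(ℝ, E) x),
      inner ℝ (tangentJ E x v) (tangentJ E x w) = inner ℝ v w := fun x v w ↦ hg.isHermitian x v w
  obtain ⟨η, hη, hηc⟩ := exists_isDolbeaultHarmonic_mk_eq_of_decomposition o hJ h
    (fun _ α hα ht ↦
      exists_isDolbeaultHarmonic_add_dolbeaultLaplacian_of_hodgeDecompositionSum_of_kaehlerIdentity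
        g o h8 hK hg rfl h ho hα ht) c
  refine ⟨η, ⟨hη, hηc⟩, fun β hβ ↦ ?_⟩
  exact isDolbeaultHarmonic_rep_unique o hJ ho h hβ.1 hη (hβ.2.trans hηc.symm)

/-- **`dim_ℂ ℋ^{p,q}_g = h^{p,q}` on a compact Kähler manifold, from Warner's Theorem 6.8 and the
Kähler identity**, in every bidegree (`(p + q) + m = n`): the numerical form of the
Hodge theorem for `∂̄` (Voisin (2002), Thm. 5.24; Huybrechts (2005), Cor. 3.2.9), from
`existsUnique_isDolbeaultHarmonic_mk_eq_of_hodgeDecompositionSum_of_kaehlerIdentity` by the class-map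
bijection `finrank_dolbeaultHarmonicForms_eq_hodgeNumber_of_exists`. [cite: Voisin2002, Thm. 5.24] -/
theorem finrank_dolbeaultHarmonicForms_eq_hodgeNumber_of_hodgeDecompositionSum_of_kaehlerIdentity
    [CompactSpace M] [T2Space M]
    (h8 : ∀ k m, letI : RiemannianBundle (fun x : M ↦ TangentSpace 𝓘(ℝ, E) x) := ⟨g.toRiemannianMetric⟩
      harmonicForms_sup_exactSmoothForms_sup_span_mcoderiv (k := k) (m := m) 𝓘(ℝ, E) o)
    (hK : ∀ {k m : ℕ},
      cHodgeLaplacian_eq_two_smul_dolbeaultLaplacian_of_isManifold_complex (k := k) (m := m) g o)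
    (hg : g.toRiemannianMetric.IsKaehler) {p q m : ℕ} (h : (p + q) + m = n)
    (ho : letI : RiemannianBundle (fun x : M ↦ TangentSpace 𝓘(ℝ, E) x) := ⟨g.toRiemannianMetric⟩
      IsSmoothForm (riemannianVolumeForm o)) :
    letI : RiemannianBundle (fun x : M ↦ TangentSpace 𝓘(ℝ, E) x) := ⟨g.toRiemannianMetric⟩
    finrank ℂ ↥(dolbeaultHarmonicForms o p q h) = hodgeNumber E M p q := by
  letI : RiemannianBundle (fun x : M ↦ TangentSpace 𝓘(ℝ, E) x) := ⟨g.toRiemannianMetric⟩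
  haveI : IsContMDiffRiemannianBundle 𝓘(ℝ, E) ∞ E (fun x : M ↦ TangentSpace 𝓘(ℝ, E) x) :=
    ⟨g.inner, g.contMDiff, fun _ _ _ ↦ rfl⟩
  haveI : IsContinuousRiemannianBundle E (fun x : M ↦ TangentSpace 𝓘(ℝ, E) x) :=
    ⟨g.inner, g.contMDiff.continuous, fun _ _ _ ↦ rfl⟩
  letI : MeasurableSpace E := borel E
  haveI : BorelSpace E := ⟨rfl⟩
  haveI : Fact (IsSmoothForm (riemannianVolumeForm o)) := ⟨ho⟩
  have hJ : ∀ (x : M) (v w : TangentSpace 𝓘(ℝ, E) x),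
      inner ℝ (tangentJ E x v) (tangentJ E x w) = inner ℝ v w := fun x v w ↦ hg.isHermitian x v w
  exact finrank_dolbeaultHarmonicForms_eq_hodgeNumber_of_exists o hJ h fun c ↦
    (existsUnique_isDolbeaultHarmonic_mk_eq_of_hodgeDecompositionSum_of_kaehlerIdentity g o h8 hK hg
      h ho c).exists

/-- **Hodge symmetry `h^{p,q} = h^{q,p}` — the named fact `hodgeNumber_symm_of_isKaehlerManifold` —
from Warner's Theorem 6.8 (real Hodge decomposition, sum half) and Voisin's Theorem 6.7 (the Kähler
identity `Δ_d = 2Δ_∂̄`).** Hypotheses, both existing named facts of the tree taken at every smooth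
metric `g` and orientation family `o` of `M`: `h8` — the hodge.S08 fact
`Literature.AlgebraicGeometry.Motives.harmonicForms_sup_exactSmoothForms_sup_span_mcoderiv 𝓘(ℝ, E) o`
for the Riemannian metric of `g`, in every degree, under the compactness and Hausdorffness bound by the
fact being proved (Warner (1983), Thm. 6.8; corrected closed form
`harmonicForms_sup_exactSmoothForms_sup_span_mcoderiv_of_compact`, reduced in the tree to Warner's
Thms. 6.5–6.6 by `harmonicForms_sup_exactSmoothForms_sup_span_mcoderiv_of_regularity_of_compactness`);
`hK` — the corrected C12 fact `cHodgeLaplacian_eq_two_smul_dolbeaultLaplacian_of_isManifold_complex g o`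
in every degree (Voisin (2002), Thm. 6.7; reduced in the tree to the first-order identities of
Prop. 6.5). Proof (Voisin (2002), Cor. 6.12 with Lemma 6.18; Huybrechts (2005), Cor. 3.2.12): pick a
smooth Kähler metric `g` (`IsKaehlerManifold.exists_isKaehler`) and the complex orientation
(`exists_isSmoothForm_riemannianVolumeForm_of_isManifold_complex`); for `p + q ≤ n`,
`h^{p,q} = dim ℋ^{p,q}`
(`finrank_dolbeaultHarmonicForms_eq_hodgeNumber_of_hodgeDecompositionSum_of_kaehlerIdentity`),
`\overline{ℋ^{p,q}} = ℋ^{q,p}` (`dolbeaultHarmonicForms_conj_of_isManifold_complex_of_cHodgeLaplacian_eq_two_smul`,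
from `hK`) and conjugation preserves `dim_ℂ` (`finrank_map_conjₛₗ`); for `p + q > n` both sides vanish
(`hodgeNumber_eq_zero_of_finrank_real_lt`). With this theorem
the only unproved ingredients of Hodge symmetry in the tree are Warner's Thm. 6.8 for `Δ_d` (elliptic
theory, Thms. 6.5–6.6) and the Kähler identities — the elliptic theory of `Δ_∂̄` is not needed.
[cite: Voisin2002, §6.1.3 Cor. 6.12] -/
theorem hodgeNumber_symm_of_isKaehlerManifold_of_hodgeDecompositionSum_of_kaehlerIdentity
    (h8 : ∀ (g : ContMDiffRiemannianMetric 𝓘(ℝ, E) ∞ E (fun x : M ↦ TangentSpace 𝓘(ℝ, E) x))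
      (o : (x : M) → Orientation ℝ (TangentSpace 𝓘(ℝ, E) x) (Fin n)) [CompactSpace M] [T2Space M]
      (k m : ℕ),
      letI : RiemannianBundle (fun x : M ↦ TangentSpace 𝓘(ℝ, E) x) := ⟨g.toRiemannianMetric⟩
      harmonicForms_sup_exactSmoothForms_sup_span_mcoderiv (k := k) (m := m) 𝓘(ℝ, E) o)
    (hK : ∀ (g : ContMDiffRiemannianMetric 𝓘(ℝ, E) ∞ E (fun x : M ↦ TangentSpace 𝓘(ℝ, E) x))
      (o : (x : M) → Orientation ℝ (TangentSpace 𝓘(ℝ, E) x) (Fin n)) {k m : ℕ},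
      cHodgeLaplacian_eq_two_smul_dolbeaultLaplacian_of_isManifold_complex (k := k) (m := m) g o) :
    hodgeNumber_symm_of_isKaehlerManifold (E := E) (M := M) := by
  intro _ _ _ p q
  obtain ⟨g, hg⟩ := IsKaehlerManifold.exists_isKaehler (E := E) (M := M)
  by_cases hpq : p + q ≤ n
  · obtain ⟨m, hm⟩ : ∃ m, (p + q) + m = n := ⟨n - (p + q), by omega⟩
    have hm' : (q + p) + m = n := by omega
    letI : RiemannianBundle (fun x : M ↦ TangentSpace 𝓘(ℝ, E) x) := ⟨g.toRiemannianMetric⟩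
    obtain ⟨o, ho⟩ := exists_isSmoothForm_riemannianVolumeForm_of_isManifold_complex (n := n) g
    have h1 : finrank ℂ ↥(dolbeaultHarmonicForms o p q hm) = hodgeNumber E M p q :=
      finrank_dolbeaultHarmonicForms_eq_hodgeNumber_of_hodgeDecompositionSum_of_kaehlerIdentity g o
        (h8 g o) (hK g o) hg hm ho
    have h2 : finrank ℂ ↥(dolbeaultHarmonicForms o q p hm') = hodgeNumber E M q p :=
      finrank_dolbeaultHarmonicForms_eq_hodgeNumber_of_hodgeDecompositionSum_of_kaehlerIdentity g o
        (h8 g o) (hK g o) hg hm' ho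
    have h3 : (dolbeaultHarmonicForms o p q hm).map (MForm.conjₛₗ (p + q)) =
        dolbeaultHarmonicForms o q p hm :=
      dolbeaultHarmonicForms_conj_of_isManifold_complex_of_cHodgeLaplacian_eq_two_smul g o (hK g o)
        hg hm p q ho
    rw [← h1, ← h2, ← finrank_map_conjₛₗ (dolbeaultHarmonicForms o p q hm), h3]
    exact finrank_dolbeaultHarmonicForms_congr_deg o (Nat.add_comm p q) hm hm'
  · -- beyond the real dimension there are no forms at all
    have hlt : finrank ℝ E < p + q := by rw [Fact.out (p := finrank ℝ E = n)]; omega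
    rw [hodgeNumber_eq_zero_of_finrank_real_lt hlt,
      hodgeNumber_eq_zero_of_finrank_real_lt (by omega)]

/-- **Hodge symmetry from the corrected closed hodge.S08 fact and the Kähler identity** — the same
reduction with Warner's Theorem 6.8 taken in its corrected closed form
`harmonicForms_sup_exactSmoothForms_sup_span_mcoderiv_of_compact 𝓘(ℝ, E) M o k m` (Warner's standing
hypotheses bound in the `def`; definitionally the predicate at a compact manifold,
`harmonicForms_sup_exactSmoothForms_sup_span_mcoderiv_of_compact_iff`). The closed discharge
`hodgeNumber_symm_of_isKaehlerManifold_holds` is this theorem at `n := finrank ℝ E` (`Fact.mk rfl`)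
fed the two upstream discharges `harmonicForms_sup_exactSmoothForms_sup_span_mcoderiv_of_compact_holds`
and `cHodgeLaplacian_eq_two_smul_dolbeaultLaplacian_of_isManifold_complex_holds`, once they exist.
[cite: Voisin2002, §6.1.3 Cor. 6.12] -/
theorem hodgeNumber_symm_of_isKaehlerManifold_of_hodgeDecompositionSum_of_compact_of_kaehlerIdentity
    (h8 : ∀ (g : ContMDiffRiemannianMetric 𝓘(ℝ, E) ∞ E (fun x : M ↦ TangentSpace 𝓘(ℝ, E) x))
      (o : (x : M) → Orientation ℝ (TangentSpace 𝓘(ℝ, E) x) (Fin n)) [CompactSpace M] [T2Space M]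
      (k m : ℕ),
      letI : RiemannianBundle (fun x : M ↦ TangentSpace 𝓘(ℝ, E) x) := ⟨g.toRiemannianMetric⟩
      haveI : IsContMDiffRiemannianBundle 𝓘(ℝ, E) ∞ E (fun x : M ↦ TangentSpace 𝓘(ℝ, E) x) :=
        ⟨g.inner, g.contMDiff, fun _ _ _ ↦ rfl⟩
      harmonicForms_sup_exactSmoothForms_sup_span_mcoderiv_of_compact 𝓘(ℝ, E) M o k m)
    (hK : ∀ (g : ContMDiffRiemannianMetric 𝓘(ℝ, E) ∞ E (fun x : M ↦ TangentSpace 𝓘(ℝ, E) x))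
      (o : (x : M) → Orientation ℝ (TangentSpace 𝓘(ℝ, E) x) (Fin n)) {k m : ℕ},
      cHodgeLaplacian_eq_two_smul_dolbeaultLaplacian_of_isManifold_complex (k := k) (m := m) g o) :
    hodgeNumber_symm_of_isKaehlerManifold (E := E) (M := M) :=
  hodgeNumber_symm_of_isKaehlerManifold_of_hodgeDecompositionSum_of_kaehlerIdentity
    (fun g o _ _ k m ↦ by
      letI : RiemannianBundle (fun x : M ↦ TangentSpace 𝓘(ℝ, E) x) := ⟨g.toRiemannianMetric⟩
      haveI : IsContMDiffRiemannianBundle 𝓘(ℝ, E) ∞ E (fun x : M ↦ TangentSpace 𝓘(ℝ, E) x) :=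
        ⟨g.inner, g.contMDiff, fun _ _ _ ↦ rfl⟩
      exact (harmonicForms_sup_exactSmoothForms_sup_span_mcoderiv_of_compact_iff 𝓘(ℝ, E) M o k m).1
        (h8 g o k m))
    hK

end Assembly

end Literature.NumberTheory.Transcendental
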